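import Summits.BirchSwinnertonDyer.Rank1Residual.X11a.ClassClosureRamTwist
import Summits.BirchSwinnertonDyer.Rank1Residual.AdditivePotMult.TwistSupplyJ
import Summits.BirchSwinnertonDyer.Rank1Residual.AdditivePotMult.TwistSupplyRam
import HarnessLib

/-!
# Class X11a, class-closure N7: the T-BCRAM census atom `RamOverQuadraticTwistAt` IS the
# `j`-witness — kernel semantics for the obsanat column (cell `b2b-bsdres`, unit `b2b-bsdres-x11a`, gen 24)

HONEST FRAMING (run/shared/lean/b2b/bsd-rank1-residual/, verbatim in every file): the goal of the
cell is to DELETE the COMBINATION-SHAPED residual classes of the Birch–Swinnerton-Dyer formula for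
ALL analytic-rank `≤ 1` elliptic curves over `ℚ` — "full BSD formula for every rank `≤ 1` curve in
class `C`" assembled STRICTLY from published theorems — so that the rank-`≤ 1` remainder becomes
exactly the CONSTRUCTION-SHAPED classes, which are TYPED (missing-input `Prop`s), NOT attempted.
This is not "finishing BSD". Research route; NO CLAIM BEYOND STATED CLASSES. Theorems only; no
definition, no named fact; nothing booked; no label change.

WHAT. `X11a/ClassClosureRamTwist.lean` (cc-typer-3, p250923) typed the class-closure census atom
`X11a.RamOverQuadraticTwistAt W p` ("some quadratic twist `E^{(d)}`, `d ≠ 0`, `p ∤ d`, has a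
globally minimal model `W₁` with a (ram) prime for `p`") and recorded that the instrument `obsanat`
(HOME/class-closure/N7/SUBPARTITION.md, column T-BCRAM) computes instead the condition "an additive,
potentially multiplicative prime `q ≠ p` of `E` with `p ∤ v_q(j(E))`", the implication being
"Tate's algorithm for twists and NOT proved in this file". THIS FILE proves it, in both directions,
from the additive sub-cell's twist-supply theorems (`AdditivePotMult/TwistSupplyJ.lean`,
`TwistSupplyRam.lean`, additive-p1 gens 3–4):

* `ramOverQuadraticTwistAt_of_jWitness` — a `j`-WITNESS (`q ≠ p` prime, `ord_q j(E) < 0`,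
  `p ∤ ord_q j(E)`) gives the atom: twist `E` into multiplicative reduction at `q`
  (`exists_twist_mult_of_padicValRat_j_neg`), normalise the parameter to a square-free integer `t`,
  replace `t` by an integer `x` with `p ∤ x` and `t x ∈ ℚ_q^{×2}` (`exists_mul_isSquare_padic_not_dvd`;
  the twists by `t` and by `x = t·(tx)/t²` are `ℚ_q`-isomorphic), take a globally minimal model `W₁`
  of `E^{(x)}`: it is multiplicative at `q` with `ord_q Δ_min(W₁) = −ord_q j(E)` prime to `p`.
* `exists_jWitness_of_ramOverQuadraticTwistAt` — conversely the (ram) prime of the twist model is a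
  `j`-witness of `E` (`j` is a twist invariant; `ord_q Δ_min = −ord_q j` at a multiplicative prime).
* `ramOverQuadraticTwistAt_iff_jWitness` — so the atom is the DECIDABLE `j`-criterion, for every
  globally minimal `E` and every `p` (no class hypothesis; the clause `p ∤ d` costs nothing).
* `addv_of_jWitness_of_not_ram`, `ramOverQuadraticTwistAt_iff_potMult_of_not_ram` — on a pair
  WITHOUT (ram) (class X11a) a `j`-witness `q` is automatically an ADDITIVE (potentially
  multiplicative) prime of `E`, so the atom is LITERALLY obsanat's bit "additive pot-mult `q ≠ p`
  with `p ∤ v_q(j)`" (census of record, x11a gen 23 / obsanat 0.2.x: 251 of the 727 N7 cells —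
  214 @3, 29 @5, 8 @7, 0 @13 — carry it; 221 surjective-leaf cells and the 255 non-surjective ones
  do not or cannot use it).
* `bsdp_of_jWitness_of_ramTwistLowerBound` — the T-BCRAM consumer `bsdp_of_ramOverQuadraticTwist`
  restated on the `j`-witness.

Reading (unchanged, cc-typer-3 / x11a gen 23): T-BCRAM names the SAME missing input as T-X11A
(`ramTwistLowerBoundAt_iff_mazurMainConjectureAt`); this file only certifies the census column's
semantics in the kernel. Nothing here is new mathematics (Silverman *AEC* VII.5.1, *ATAEC* V.5.3,
weak approximation for square classes).

References: [SilvermanAEC2009] VII.5 Prop. 5.1(b), X.5 Cor. 5.4; [Silverman1994] V.5.3;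
HOME/class-closure/N7/SUBPARTITION.md; HOME/b2b-bsdres-x11a/REPORT-g24.md.
-/

noncomputable section

open scoped Classical

open WeierstrassCurve Literature.NumberTheory.EllipticCurves
  Literature.NumberTheory.EllipticCurves.ModularForms
  Literature.NumberTheory.EllipticCurves.Rank1Residual
  Literature.NumberTheory.EllipticCurves.Rank1Residual.Typed
  Literature.NumberTheory.EllipticCurves.Wuthrich2014
  Literature.NumberTheory.EllipticCurves.SteinWuthrich2013
  Literature.NumberTheory.EllipticCurves.Skinner2016
  Summit.BirchSwinnertonDyer.Rank1Residual.AdditivePotMult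

set_option autoImplicit false

namespace Summit.BirchSwinnertonDyer.Rank1Residual.X11a

variable (W : WeierstrassCurve ℚ) [W.IsElliptic] [W.IsGloballyMinimal] (p : ℕ) [Fact p.Prime]

omit [W.IsGloballyMinimal] in
/-- **A `j`-witness gives the T-BCRAM atom.** If `q ≠ p` is a prime with `ord_q j(E) < 0` and
`p ∤ ord_q j(E)`, then some quadratic twist `E^{(x)}` with `x ∈ ℤ`, `x ≠ 0`, `p ∤ x` has a globally
minimal model carrying a (ram) prime for `p` (namely `q`). Proof: a twist `E^{(a)}` multiplicative
at `q` (Silverman *ATAEC* V.5.3); `a = c² t` with `t` square-free, so `E^{(t)} ≅ E^{(a)}`; an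
integer `x ≠ 0`, `p ∤ x`, with `t x` a `q`-adic square, so `E^{(x)} ≅ E^{(t · tx)}` is still
multiplicative at `q`; on a globally minimal model `W₁` of `E^{(x)}`, `ord_q Δ_min(W₁) = −ord_q j(E)`
(*AEC* VII.5.1(b), `j` twist-invariant) is prime to `p`.
[cite: SilvermanAEC2009, VII.5 Prop. 5.1(b) and X.5 Cor. 5.4] [cite: Silverman1994, V.5.3] -/
theorem ramOverQuadraticTwistAt_of_jWitness {q : ℕ} (hq : q.Prime) (hqp : q ≠ p)
    (hjq : padicValRat q W.j < 0) (hpj : ¬ (p : ℤ) ∣ padicValRat q W.j) :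
    RamOverQuadraticTwistAt W p := by
  haveI : Fact q.Prime := ⟨hq⟩
  have hp : p.Prime := Fact.out
  -- a twist multiplicative at `q`
  obtain ⟨a, ha, hmq⟩ := exists_twist_mult_of_padicValRat_j_neg (W := W) hjq
  -- square-free normalisation of the parameter
  obtain ⟨c, t, hc, ht, hat⟩ := Rat.exists_sq_mul_squarefree ha
  have ht0 : t ≠ 0 := by
    rintro rfl
    apply ha
    rw [hat]; simp
  have ht0' : (t : ℚ) ≠ 0 := by exact_mod_cast ht0
  haveI := W.isElliptic_quadraticTwist ht0'
  have hmt : Mult (W.quadraticTwist (t : ℚ)) q := by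
    obtain ⟨C, hC⟩ := W.exists_variableChange_quadraticTwist_mul_sq (t : ℚ) c hc
    have ha' : W.quadraticTwist a = W.quadraticTwist ((t : ℚ) * c ^ 2) := by rw [hat, mul_comm]
    rw [ha', ← hC] at hmq
    exact (hasMultiplicativeReductionAtPrime_smul_iff (W.quadraticTwist (t : ℚ)) C q).mp hmq
  -- `q`-adic adjustment: an integer `x`, `p ∤ x`, with `t x` a `q`-adic square
  obtain ⟨x, hx0, hpx, hsq⟩ := exists_mul_isSquare_padic_not_dvd ht0 ht (q := q) hp (Ne.symm hqp)
  have hx0' : (x : ℚ) ≠ 0 := by exact_mod_cast hx0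
  haveI := W.isElliptic_quadraticTwist hx0'
  have hmx : Mult (W.quadraticTwist (x : ℚ)) q := by
    have hy0 : ((t * x : ℤ) : ℚ) ≠ 0 := by exact_mod_cast mul_ne_zero ht0 hx0
    have hsq' : IsSquare (algebraMap ℚ ℚ_[q] ((t * x : ℤ) : ℚ)) := by simpa using hsq
    have h1 : Mult (W.quadraticTwist ((t : ℚ) * ((t * x : ℤ) : ℚ))) q :=
      mult_quadraticTwist_mul_of_padicSquare ht0' hy0 hsq' hmt
    have hxt : ((t : ℚ) * ((t * x : ℤ) : ℚ)) = (x : ℚ) * (t : ℚ) ^ 2 := by push_cast; ring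
    rw [hxt] at h1
    obtain ⟨C, hC⟩ := W.exists_variableChange_quadraticTwist_mul_sq (x : ℚ) (t : ℚ) ht0'
    rw [← hC] at h1
    exact (hasMultiplicativeReductionAtPrime_smul_iff (W.quadraticTwist (x : ℚ)) C q).mp h1
  -- a globally minimal model of `E^{(x)}`; its (ram) prime is `q`
  obtain ⟨W₁, iW₁, iW₁m, C₁, hC₁⟩ := exists_globallyMinimal_model_twist W hx0'
  have hmult₁ : Mult W₁ q := mult_of_model_twist hx0' hmx ⟨C₁, hC₁⟩
  have hv₁ : ¬ p ∣ padicValInt q W₁.minimalDiscriminantInt := by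
    rw [dvd_padicValInt_minimalDiscriminantInt_iff_of_mult W₁ q hmult₁ p,
      j_of_model_twist hx0' ⟨C₁, hC₁⟩]
    exact hpj
  exact ⟨x, W₁, iW₁, iW₁m, hx0, hpx, ⟨C₁⁻¹, by rw [← hC₁, inv_smul_smul]⟩,
    q, ⟨hq⟩, hqp, hmult₁, hv₁⟩

omit [W.IsGloballyMinimal] in
/-- **The T-BCRAM atom gives a `j`-witness.** If some twist `E^{(d)}` (`d ≠ 0`) has a globally
minimal model `W₁` with a (ram) prime `ℓ ≠ p` (`Mult W₁ ℓ`, `p ∤ ord_ℓ Δ_min(W₁)`), then `ℓ` is a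
`j`-witness of `E`: `ord_ℓ j(E) = ord_ℓ j(W₁) = −ord_ℓ Δ_min(W₁) < 0` and `p ∤ ord_ℓ j(E)`
(additive-p1's `exists_jWitness_of_ram`, `j` twist-invariant). The clause `p ∤ d` is not used.
[cite: SilvermanAEC2009, VII.5 Prop. 5.1(b)] -/
theorem exists_jWitness_of_ramOverQuadraticTwistAt (h : RamOverQuadraticTwistAt W p) :
    ∃ q : ℕ, q.Prime ∧ q ≠ p ∧ padicValRat q W.j < 0 ∧ ¬ (p : ℤ) ∣ padicValRat q W.j := by
  obtain ⟨d, W₁, iW₁, iW₁m, hd0, -, ⟨C, hC⟩, hram⟩ := h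
  have hd0' : (d : ℚ) ≠ 0 := by exact_mod_cast hd0
  obtain ⟨q, hq, hqp, hneg, hndvd⟩ := exists_jWitness_of_ram (W := W₁) (p := p) hram
  have hj : W₁.j = W.j :=
    j_of_model_twist (W := W) hd0' ⟨C⁻¹, by rw [← hC, inv_smul_smul]⟩
  exact ⟨q, hq, hqp, hj ▸ hneg, hj ▸ hndvd⟩

omit [W.IsGloballyMinimal] in
/-- **The T-BCRAM census atom IS the `j`-criterion** (for every globally minimal `E/ℚ` and every
prime `p`): `RamOverQuadraticTwistAt W p` iff some prime `q ≠ p` has `ord_q j(E) < 0` and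
`p ∤ ord_q j(E)`. In particular the atom is decidable from `(j(E), p)` — the primes `q` range over
the prime divisors of the denominator of `j(E)`. [cite: SilvermanAEC2009, VII.5 Prop. 5.1(b)]
[cite: Silverman1994, V.5.3] -/
theorem ramOverQuadraticTwistAt_iff_jWitness :
    RamOverQuadraticTwistAt W p ↔
      ∃ q : ℕ, q.Prime ∧ q ≠ p ∧ padicValRat q W.j < 0 ∧ ¬ (p : ℤ) ∣ padicValRat q W.j :=
  ⟨exists_jWitness_of_ramOverQuadraticTwistAt W p,
    fun ⟨_, hq, hqp, hjq, hpj⟩ => ramOverQuadraticTwistAt_of_jWitness W p hq hqp hjq hpj⟩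

omit [W.IsGloballyMinimal] in
/-- **No `j`-witness, no T-BCRAM atom**: if every prime `q ≠ p` with `ord_q j(E) < 0` has
`p ∣ ord_q j(E)`, then NO twist of `E` (with or without `p ∤ d`) has a model with a (ram) prime for
`p` — the census verdict `FAILS:(ram) acquired over a quadratic base change` is structural
(additive-p1's `not_ram_model_twist_of_forall_dvd`, restated on the atom). [folklore] -/
theorem not_ramOverQuadraticTwistAt_of_forall_dvd
    (hall : ∀ q : ℕ, q.Prime → q ≠ p → padicValRat q W.j < 0 → (p : ℤ) ∣ padicValRat q W.j) :
    ¬ RamOverQuadraticTwistAt W p := by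
  intro h
  obtain ⟨q, hq, hqp, hneg, hndvd⟩ := exists_jWitness_of_ramOverQuadraticTwistAt W p h
  exact hndvd (hall q hq hqp hneg)

/-- **On a pair without (ram), a `j`-witness is an ADDITIVE potentially multiplicative prime.** If
`¬ Ram W p` and `q ≠ p` is a prime with `ord_q j(E) < 0`, `p ∤ ord_q j(E)`, then `E` has additive
reduction at `q`: not good (`ord_q j ≥ 0` at a good prime, *AEC* VII.5.1(a)) and not multiplicative
(else `p ∤ ord_q Δ_min = −ord_q j` would be a (ram) witness). [cite: SilvermanAEC2009, VII.5 Prop. 5.1] -/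
theorem addv_of_jWitness_of_not_ram (hram : ¬ Ram W p) {q : ℕ} [hq : Fact q.Prime] (hqp : q ≠ p)
    (hjq : padicValRat q W.j < 0) (hpj : ¬ (p : ℤ) ∣ padicValRat q W.j) : Addv W q := by
  refine ⟨fun hgood => ?_, fun hmult => ?_⟩
  · have h := EisensteinPrimes.padicValRat_j_eq_of_good W q hgood
    have h0 : (0 : ℤ) ≤ 3 * (padicValInt q (integralModelInt W).c₄ : ℤ) := by positivity
    omega
  · exact hram ⟨q, hq, hqp, hmult,
      by rwa [dvd_padicValInt_minimalDiscriminantInt_iff_of_mult W q hmult p]⟩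

/-- **On a pair without (ram) the T-BCRAM atom is LITERALLY obsanat's bit**: `RamOverQuadraticTwistAt W p`
iff `E` has an ADDITIVE prime `q ≠ p` which is potentially multiplicative (`ord_q j(E) < 0`) with
`p ∤ ord_q j(E)` (HOME/class-closure/N7/SUBPARTITION.md, "(ram) over a quadratic base change: YES /
no (no additive pot-mult q with p∤v_q(j))"; x11a gen 23 census: 251 of the 727 N7 cells, 214 @3 /
29 @5 / 8 @7 / 0 @13). [cite: SilvermanAEC2009, VII.5 Prop. 5.1] [cite: Silverman1994, V.5.3] -/
theorem ramOverQuadraticTwistAt_iff_potMult_of_not_ram (hram : ¬ Ram W p) :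
    RamOverQuadraticTwistAt W p ↔
      ∃ q : ℕ, ∃ _ : Fact q.Prime, q ≠ p ∧ Addv W q ∧ padicValRat q W.j < 0 ∧
        ¬ (p : ℤ) ∣ padicValRat q W.j := by
  rw [ramOverQuadraticTwistAt_iff_jWitness]
  constructor
  · rintro ⟨q, hq, hqp, hjq, hpj⟩
    haveI : Fact q.Prime := ⟨hq⟩
    exact ⟨q, inferInstance, hqp, addv_of_jWitness_of_not_ram W p hram hqp hjq hpj, hjq, hpj⟩
  · rintro ⟨q, hq, hqp, -, hjq, hpj⟩
    exact ⟨q, hq.out, hqp, hjq, hpj⟩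

/-- **On class X11a the atom is the potentially-multiplicative bit** (X11a has no (ram) prime by
definition: `ClassX11a.not_ram`). [folklore] -/
theorem ClassX11a.ramOverQuadraticTwistAt_iff_potMult (hX : ClassX11a W p) :
    RamOverQuadraticTwistAt W p ↔
      ∃ q : ℕ, ∃ _ : Fact q.Prime, q ≠ p ∧ Addv W q ∧ padicValRat q W.j < 0 ∧
        ¬ (p : ℤ) ∣ padicValRat q W.j :=
  ramOverQuadraticTwistAt_iff_potMult_of_not_ram W p hX.not_ram

/-- **T-BCRAM consumer on the `j`-witness**: on class X11a at `p ≥ 5` with `ρ̄_{E,p}` onto, a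
`j`-witness `q` plus the typed OPEN input `RamTwistLowerBoundAt W p W₁` for every (ram)-carrying
twist model with `p ∤ d`, together with the PUBLISHED named facts of `bsdp_of_ramOverQuadraticTwist`
(Kato–Wuthrich A32, Skinner 2016 Thm. A, Stein–Wuthrich 2013 Thm. 6.1 ×2, Greenberg–Stevens, GZK,
modularity), give `BSD(E,p)`. Same missing input as the chain of record (cc-typer-3's
`ramTwistLowerBoundAt_iff_mazurMainConjectureAt`); nothing booked.
[cite: Skinner2016PacificMC, Thm. A] [cite: SteinWuthrich2013, Thm. 6.1 (p. 20)] -/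
theorem bsdp_of_jWitness_of_ramTwistLowerBound (hNf : exists_isNewformOf)
    (hKato : kato_charIdeal_dvd_multiplicative_of_surjective) (hA : thmA_charIdeal_multiplicative)
    (hJs : thm61_splitMultiplicative) (hJn : thm61_nonsplitMultiplicative)
    (hGZK : rank_eq_analyticRank_of_analyticRank_le_one)
    (hGS : greenberg_stevens (W := W) (p := p))
    (hX : ClassX11a W p) (hp : 5 ≤ p) (hsurj : Surj W p)
    {q : ℕ} (hq : q.Prime) (hqp : q ≠ p) (hjq : padicValRat q W.j < 0)
    (hpj : ¬ (p : ℤ) ∣ padicValRat q W.j)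
    (hBC : ∀ (W₁ : WeierstrassCurve ℚ) [W₁.IsElliptic] [W₁.IsGloballyMinimal], Ram W₁ p →
      (∃ (d : ℤ) (C : VariableChange ℚ), ¬ (p : ℤ) ∣ d ∧ C • W₁ = W.quadraticTwist (d : ℚ)) →
      RamTwistLowerBoundAt W p W₁) : BSDp W p :=
  bsdp_of_ramOverQuadraticTwist W p hNf hKato hA hJs hJn hGZK hGS hX hp hsurj
    (ramOverQuadraticTwistAt_of_jWitness W p hq hqp hjq hpj) hBC

end Summit.BirchSwinnertonDyer.Rank1Residual.X11a

end
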